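import Literature.NumberTheory.Transcendental.NesterenkoElimination
import Literature.RingTheory.MvPolynomial.HomogeneousHilbertFunction
import Mathlib.LinearAlgebra.FiniteDimensional.Lemmas
import HarnessLib

/-!
# Hilbert function of a space curve on a complete intersection, II: telescoping and evaluation (crux `ApproximationProperty`, stub `CycleAPIAt3`)

Crux `stmt-Schanuel-6117` (`Summit.Schanuel.Schanuel.Theses.DiophantineDichotomy.ApproximationProperty`),
line `orbit-interpolation-determinant`, registered stub `CycleAPIAt3 : CycleAPIAt 3`; second file of the
curve Hilbert-function lower bound (see `…CurveHilbertSection.lean`). Everything here is PROVED; no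
definitions, no named facts. Two elementary facts about the Hilbert function
`H(I; t) = dim S_t − dim I_t` of an ideal of a polynomial ring:

* `CurveHilbert.hilbert_add_eq_sum` — **telescoping along a linear non-zero-divisor**: if the linear
  form `ℓ` is a non-zero-divisor modulo the homogeneous ideal `I`, then
  `H(I; n + k) = H(I; n) + ∑_{i<k} H(I + (ℓ); n + i + 1)` (the hypersurface-section formula
  `hilbert_sup_span_add_hilbert_eq`, `k` times); `CurveHilbert.hilbert_add_mul_le` — hence
  `H(I; n) + k·D ≤ H(I; n + k)` when `H(I + (ℓ); j) ≥ D` on `(n, n + k]`.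
* `CurveHilbert.le_hilbert_of_zeros` — **pairwise non-proportional common zeros impose independent
  conditions in high degree**: if `β₁, …, β_N ∈ ℂ^{m+1} ∖ 0` are pairwise non-proportional zeros of every
  element of an ideal `J ⊆ ℚ[x₀, …, x_m]`, then `H(J; j) ≥ N` for `j ≥ N − 1` (the evaluation map
  `ℚ[x̲]_j → ℂ^N` kills `J_j`, and the `ℂ`-span of its image is everything: for each `i` the form
  `∏_{k ≠ i} λ_{ik} · x_c^{j+1−N}`, `λ_{ik}` linear with `λ_{ik}(β_k) = 0 ≠ λ_{ik}(βᵢ)`, maps to a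
  non-zero multiple of the `i`-th basis vector; registered helper `curveHilbert_zerosImpose`).

Sources: Philippon, Bull. SMF 114 (1986), Lemme 3.1; M. Chardin, Bull. SMF 117 (1989) (Hilbert
functions and interpolation); folklore linear algebra.
-/

set_option linter.dupNamespace false

noncomputable section

namespace Summit.Schanuel.Schanuel.Cruxes.ApproximationProperty.OrbitInterpolationDeterminant

open Literature.NumberTheory.Transcendental.Nesterenko MvPolynomial Module
open Literature.RingTheory.MvPolynomial

attribute [local instance] MvPolynomial.gradedAlgebra

namespace CurveHilbert

/-! ## Telescoping along a linear non-zero-divisor -/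

/-- **`H(I; n + k) = H(I; n) + ∑_{i<k} H(I + (ℓ); n + i + 1)`** for a homogeneous ideal `I` and a
linear form `ℓ` which is a non-zero-divisor modulo `I`. [cite: Philippon1986, Lemme 3.1] -/
theorem hilbert_add_eq_sum {K : Type*} [Field K] {σ : Type*} [Finite σ]
    {I : Ideal (MvPolynomial σ K)} (hI : I.IsHomogeneous (homogeneousSubmodule σ K))
    {ℓ : MvPolynomial σ K} (hℓ0 : ℓ ≠ 0) (hℓ1 : ℓ.IsHomogeneous 1)
    (hnzd : ∀ f, ℓ * f ∈ I → f ∈ I) (n k : ℕ) :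
    finrank K (homogeneousSubmodule σ K (n + k)) - finrank K (idealDegree I (n + k)) =
      (finrank K (homogeneousSubmodule σ K n) - finrank K (idealDegree I n)) +
        ∑ i ∈ Finset.range k,
          (finrank K (homogeneousSubmodule σ K (n + i + 1)) -
            finrank K (idealDegree (I ⊔ Ideal.span {ℓ}) (n + i + 1))) := by
  induction k with
  | zero => simp
  | succ k ih =>
    rw [Finset.sum_range_succ, show n + (k + 1) = n + k + 1 from rfl]
    have h := hilbert_sup_span_add_hilbert_eq hI hℓ0 hℓ1 hnzd (n + k)
    omega

/-- **`H(I; n) + k · D ≤ H(I; n + k)`** when `H(I + (ℓ); j) ≥ D` for `n < j ≤ n + k`, `ℓ` a linear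
non-zero-divisor modulo the homogeneous ideal `I`. [cite: Philippon1986, Lemme 3.1] -/
theorem hilbert_add_mul_le {K : Type*} [Field K] {σ : Type*} [Finite σ]
    {I : Ideal (MvPolynomial σ K)} (hI : I.IsHomogeneous (homogeneousSubmodule σ K))
    {ℓ : MvPolynomial σ K} (hℓ0 : ℓ ≠ 0) (hℓ1 : ℓ.IsHomogeneous 1)
    (hnzd : ∀ f, ℓ * f ∈ I → f ∈ I) {n k D : ℕ}
    (hD : ∀ i, i < k → D ≤ finrank K (homogeneousSubmodule σ K (n + i + 1)) -
      finrank K (idealDegree (I ⊔ Ideal.span {ℓ}) (n + i + 1))) :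
    (finrank K (homogeneousSubmodule σ K n) - finrank K (idealDegree I n)) + k * D ≤
      finrank K (homogeneousSubmodule σ K (n + k)) - finrank K (idealDegree I (n + k)) := by
  rw [hilbert_add_eq_sum hI hℓ0 hℓ1 hnzd n k]
  refine Nat.add_le_add_left ?_ _
  calc k * D = ∑ _i ∈ Finset.range k, D := by simp [Finset.sum_const, Finset.card_range]
    _ ≤ _ := Finset.sum_le_sum fun i hi => hD i (Finset.mem_range.mp hi)

/-! ## Pairwise non-proportional common zeros impose independent conditions in high degree -/

section Zeros

variable {m N : ℕ} (β : Fin N → (Fin (m + 1) → ℂ))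

/-- A linear form `λ = b_q x_p − b_p x_q` over `ℂ` (vanishing at `b`). [folklore] -/
theorem isHomogeneous_linPQ (b : Fin (m + 1) → ℂ) (p q : Fin (m + 1)) :
    (C (b q) * X p - C (b p) * X q : MvPolynomial (Fin (m + 1)) ℂ).IsHomogeneous 1 := by
  have h1 : (C (b q) * X p : MvPolynomial (Fin (m + 1)) ℂ).IsHomogeneous 1 := by
    simpa using (isHomogeneous_C _ (b q)).mul (isHomogeneous_X ℂ p)
  have h2 : (C (b p) * X q : MvPolynomial (Fin (m + 1)) ℂ).IsHomogeneous 1 := by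
    simpa using (isHomogeneous_C _ (b p)).mul (isHomogeneous_X ℂ q)
  exact h1.sub h2

/-- For pairwise non-proportional non-zero vectors `β₁, …, β_N` and `j + 1 ≥ N`, a complex form of
degree `j` vanishing at all `β_k`, `k ≠ i`, but not at `βᵢ`. [folklore] -/
theorem exists_form_separating (hβ0 : ∀ i, β i ≠ 0)
    (hsep : ∀ i k, i ≠ k → ∃ p q, β i p * β k q ≠ β i q * β k p) {j : ℕ} (hj : N ≤ j + 1)
    (i : Fin N) :
    ∃ A : MvPolynomial (Fin (m + 1)) ℂ, A.IsHomogeneous j ∧ eval (β i) A ≠ 0 ∧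
      ∀ k, k ≠ i → eval (β k) A = 0 := by
  classical
  -- the linear forms `λ_{ik}`
  have hlam : ∀ k, ∃ lam : MvPolynomial (Fin (m + 1)) ℂ, lam.IsHomogeneous 1 ∧
      (k ≠ i → eval (β i) lam ≠ 0 ∧ eval (β k) lam = 0) := by
    intro k
    by_cases hk : k = i
    · exact ⟨X 0, isHomogeneous_X ℂ 0, fun h => (h hk).elim⟩
    · obtain ⟨p, q, hpq⟩ := hsep i k (Ne.symm hk)
      refine ⟨C (β k q) * X p - C (β k p) * X q, isHomogeneous_linPQ (β k) p q, fun _ => ⟨?_, ?_⟩⟩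
      · simp only [map_sub, map_mul, eval_C, eval_X]
        intro h
        apply hpq
        linear_combination h
      · simp only [map_sub, map_mul, eval_C, eval_X]
        ring
  choose lam hlam1 hlamv using hlam
  obtain ⟨c, hc⟩ := Function.ne_iff.mp (hβ0 i)
  have hN : 1 ≤ N := Nat.succ_le_of_lt i.pos
  refine ⟨(∏ k ∈ Finset.univ.erase i, lam k) * X c ^ (j + 1 - N), ?_, ?_, ?_⟩
  · have h1 : (∏ k ∈ Finset.univ.erase i, lam k).IsHomogeneous (∑ k ∈ Finset.univ.erase i, 1) :=
      IsHomogeneous.prod _ _ _ fun k _ => hlam1 k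
    rw [Finset.sum_const, smul_eq_mul, mul_one, Finset.card_erase_of_mem (Finset.mem_univ i),
      Finset.card_univ, Fintype.card_fin] at h1
    have h2 := h1.mul (isHomogeneous_X_pow (R := ℂ) c (j + 1 - N))
    rwa [show N - 1 + (j + 1 - N) = j by omega] at h2
  · rw [map_mul, map_pow, eval_X, map_prod]
    refine mul_ne_zero (Finset.prod_ne_zero_iff.mpr fun k hk => ?_) (pow_ne_zero _ hc)
    exact ((hlamv k) (Finset.ne_of_mem_erase hk)).1
  · intro k hk
    rw [map_mul, map_prod, Finset.prod_eq_zero (Finset.mem_erase.mpr ⟨hk, Finset.mem_univ k⟩)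
      ((hlamv k) hk).2, zero_mul]

/-- **`N` pairwise non-proportional common zeros give `H(J; j) ≥ N` for `j ≥ N − 1`.** Let
`J ⊆ ℚ[x₀, …, x_m]` be an ideal and `β₁, …, β_N ∈ ℂ^{m+1} ∖ 0` pairwise non-proportional vectors at
which every element of `J` vanishes. Then `dim_ℚ ℚ[x̲]_j − dim_ℚ J_j ≥ N` whenever `j + 1 ≥ N`.
[cite: Chardin1989, §1 (interpolation on finite sets); folklore] -/
theorem le_hilbert_of_zeros (J : Ideal (Rx m)) (hβ0 : ∀ i, β i ≠ 0)
    (hsep : ∀ i k, i ≠ k → ∃ p q, β i p * β k q ≠ β i q * β k p)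
    (hzero : ∀ i, ∀ f ∈ J, aeval (β i) f = 0) {j : ℕ} (hj : N ≤ j + 1) :
    N ≤ finrank ℚ (homogeneousSubmodule (Fin (m + 1)) ℚ j) - finrank ℚ (idealDegree J j) := by
  classical
  set V : Submodule ℚ (Rx m) := homogeneousSubmodule (Fin (m + 1)) ℚ j with hV
  haveI : Module.Finite ℚ V := finite_homogeneousSubmodule (K := ℚ) (σ := Fin (m + 1)) j
  -- the evaluation map
  let ev : Rx m →ₗ[ℚ] (Fin N → ℂ) :=
    LinearMap.pi fun i => ((aeval (β i) : Rx m →ₐ[ℚ] ℂ).toLinearMap)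
  have ev_apply : ∀ (f : Rx m) (i : Fin N), ev f i = aeval (β i) f := fun f i => rfl
  let evV : V →ₗ[ℚ] (Fin N → ℂ) := ev.comp V.subtype
  -- its kernel contains `J_j`
  have hle : idealDegree J j ≤ V := idealDegree_le_homogeneousSubmodule J j
  have hker : (idealDegree J j).comap V.subtype ≤ LinearMap.ker evV := by
    intro x hx
    rw [LinearMap.mem_ker]
    funext i
    change ev x.1 i = 0
    rw [ev_apply]
    exact hzero i x.1 (mem_idealDegree.mp hx).1
  have hk : finrank ℚ (idealDegree J j) ≤ finrank ℚ (LinearMap.ker evV) := by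
    rw [← (Submodule.comapSubtypeEquivOfLe hle).finrank_eq]
    exact Submodule.finrank_mono hker
  have hrn := LinearMap.finrank_range_add_finrank_ker evV
  -- the range has `ℚ`-dimension at least `N`
  set Rg : Submodule ℚ (Fin N → ℂ) := LinearMap.range evV with hRg
  set S : Submodule ℂ (Fin N → ℂ) := Submodule.span ℂ (Rg : Set (Fin N → ℂ)) with hS
  -- (1) `dim_ℂ S ≤ dim_ℚ Rg`
  have hS_le : finrank ℂ S ≤ finrank ℚ Rg := by
    let b := Module.finBasis ℚ Rg
    have hsub : (Rg : Set (Fin N → ℂ)) ⊆ Submodule.span ℂ (Set.range fun i => (b i : Fin N → ℂ)) := by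
      intro x hx
      have hx' : (⟨x, hx⟩ : Rg) = ∑ i, b.repr ⟨x, hx⟩ i • b i := (b.sum_repr ⟨x, hx⟩).symm
      have hx'' : x = ∑ i, ((b.repr ⟨x, hx⟩ i : ℚ) : ℂ) • (b i : Fin N → ℂ) := by
        have := congrArg Subtype.val hx'
        simp only [Submodule.coe_sum, Submodule.coe_smul] at this
        refine this.trans (Finset.sum_congr rfl fun i _ => ?_)
        ext k
        simp [Rat.smul_def]
      rw [hx'']
      exact Submodule.sum_mem _ fun i _ =>
        Submodule.smul_mem _ _ (Submodule.subset_span ⟨i, rfl⟩)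
    calc finrank ℂ S ≤ finrank ℂ (Submodule.span ℂ (Set.range fun i => (b i : Fin N → ℂ))) :=
          Submodule.finrank_mono (Submodule.span_le.mpr hsub)
      _ ≤ Fintype.card (Fin (finrank ℚ Rg)) := finrank_range_le_card _
      _ = finrank ℚ Rg := Fintype.card_fin _
  -- (2) `S = ⊤`: complex forms of degree `j` evaluate into `S`, and they separate the points
  have hmono : ∀ d : Fin (m + 1) →₀ ℕ, (monomial d (1 : ℚ) : Rx m) ∈ V →
      (fun i => eval (β i) (monomial d (1 : ℂ))) ∈ S := by
    intro d hd
    have hmem : ev (monomial d (1 : ℚ)) ∈ Rg := ⟨⟨monomial d 1, hd⟩, rfl⟩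
    have heq : (fun i => eval (β i) (monomial d (1 : ℂ))) = ev (monomial d (1 : ℚ)) := by
      funext i
      rw [ev_apply, aeval_def, ← eval_map, map_monomial, RingHom.map_one]
    rw [heq]
    exact Submodule.subset_span hmem
  have hformS : ∀ G : MvPolynomial (Fin (m + 1)) ℂ, G.IsHomogeneous j →
      (fun i => eval (β i) G) ∈ S := by
    intro G hG
    have hGsum : (fun i => eval (β i) G) =
        ∑ d ∈ G.support, coeff d G • fun i => eval (β i) (monomial d (1 : ℂ)) := by
      funext i
      conv_lhs => rw [G.as_sum, map_sum]
      simp only [Finset.sum_apply, Pi.smul_apply, smul_eq_mul]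
      refine Finset.sum_congr rfl fun d _ => ?_
      rw [show monomial d (coeff d G) = C (coeff d G) * monomial d 1 by
        rw [C_mul_monomial, mul_one], map_mul, eval_C]
    rw [hGsum]
    refine Submodule.sum_mem _ fun d hd => Submodule.smul_mem _ _ (hmono d ?_)
    have hdeg := hG (mem_support_iff.mp hd)
    exact isHomogeneous_monomial _ (by rw [Finsupp.degree_eq_weight_one]; exact hdeg)
  have htop : (⊤ : Submodule ℂ (Fin N → ℂ)) ≤ S := by
    have hsingle : ∀ i, (Pi.single i 1 : Fin N → ℂ) ∈ S := by
      intro i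
      obtain ⟨A, hA, hAi, hAk⟩ := exists_form_separating β hβ0 hsep hj i
      have hmem := Submodule.smul_mem S (eval (β i) A)⁻¹ (hformS A hA)
      have heq : (eval (β i) A)⁻¹ • (fun k => eval (β k) A) = Pi.single i 1 := by
        funext k
        by_cases hki : k = i
        · subst hki
          simp [hAi]
        · simp [hAk k hki, hki]
      rwa [heq] at hmem
    intro x _
    rw [← Finset.univ_sum_single x]
    refine Submodule.sum_mem _ fun i _ => ?_
    rw [show Pi.single i (x i) = x i • (Pi.single i 1 : Fin N → ℂ) by
      rw [← Pi.single_smul, smul_eq_mul, mul_one]]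
    exact Submodule.smul_mem _ _ (hsingle i)
  have hS_ge : N ≤ finrank ℂ S := by
    have h := Submodule.finrank_mono htop
    rw [finrank_top, Module.finrank_fin_fun] at h
    exact h
  -- assemble
  have hR : N ≤ finrank ℚ Rg := hS_ge.trans hS_le
  have h1 : N + finrank ℚ (idealDegree J j) ≤ finrank ℚ V :=
    calc N + finrank ℚ (idealDegree J j) ≤ finrank ℚ Rg + finrank ℚ (LinearMap.ker evV) :=
          add_le_add hR hk
      _ = finrank ℚ V := hrn
  exact Nat.le_sub_of_add_le h1

end Zeros

end CurveHilbert

/-- **Pairwise non-proportional common zeros impose independent conditions in high degree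
(registered helper `curveHilbert_zerosImpose`).** If `β₁, …, β_N ∈ ℂ^{m+1} ∖ 0` are pairwise
non-proportional and every element of the ideal `J ⊆ ℚ[x₀, …, x_m]` vanishes at each of them, then
`dim_ℚ ℚ[x̲]_j − dim_ℚ J_j ≥ N` for every `j` with `j + 1 ≥ N`. [folklore] -/
theorem curveHilbert_zerosImpose :
    ∀ (m N : ℕ) (β : Fin N → (Fin (m + 1) → ℂ)) (J : Ideal (Rx m)), (∀ i, β i ≠ 0) →
      (∀ i k, i ≠ k → ∃ p q, β i p * β k q ≠ β i q * β k p) →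
      (∀ i, ∀ f ∈ J, aeval (β i) f = 0) → ∀ j : ℕ, N ≤ j + 1 →
        N ≤ Module.finrank ℚ ↥(homogeneousSubmodule (Fin (m + 1)) ℚ j) -
          Module.finrank ℚ ↥(Literature.RingTheory.MvPolynomial.idealDegree J j) :=
  fun _ _ β J hβ0 hsep hzero _ hj => CurveHilbert.le_hilbert_of_zeros β J hβ0 hsep hzero hj

end Summit.Schanuel.Schanuel.Cruxes.ApproximationProperty.OrbitInterpolationDeterminant

end
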